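import Literature.MathematicalPhysics.QuantumLattice.GrassmannEffectiveActionTruncation
import Literature.MathematicalPhysics.QuantumLattice.GrassmannFlowIteration
import HarnessLib

/-!
# The flow of majorants with a TRACKED linear part: iterating the single-scale step without pairing factorials

Topic `MathematicalPhysics/QuantumLattice`; companion of `GrassmannFlowIteration.lean`.  There the one-step input of the
recursion is `GrassmannFlowStep.sum_norm_kernel_effAction_le_flow`, whose first-order (Wick) part counts the self-contraction
patterns of a degree-`(m+2i)` kernel one by one (`(m+2i)!/(m! i! 2^i) s^i`): sharp for a quartic input, factorially lossy
once the input has kernels in every degree — i.e. from the second slice on.  Here the first-order part of the map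
`V ↦ effAction C V`, the Gaussian convolution `e^{Δ_C} V`, is instead (i) bounded in GRAM form, `Σ_{W : W_i = w}
‖kernel_m (e^{Δ_C} H)‖ ≤ e ρ^{-m} ‖H‖_h` (the `n = 1` cumulant of `GrassmannCumulantActionBound`, no pairing count), for the
untracked part `H` of the interaction, and (ii) followed EXACTLY for a tracked part `L` (e.g. the local quartic and
quadratic terms, whose Wick images are explicit): with `V^{(j)} = L_j + H_j` and `L_{j+1} := e^{Δ_{C_j}} L_j` (modulo
constants), `H_{j+1} = e^{Δ_{C_j}} H_j + (effAction C_j V^{(j)} - e^{Δ_{C_j}} V^{(j)})` (modulo constants) and both terms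
are second-order small (Benfatto–Giuliani–Mastropietro 2006, (2.86)–(2.90): the beta function starts at second order).

* **`sum_norm_kernel_gaussConv_le_normV`** — `Σ_{W : W_i = w} ‖kernel_m (e^{Δ_C} H) (W)‖ ≤ ρ^{-m} e ‖H‖_h` for even `H`;
* **`iterEffAction_splitFlow`** — slices `C 0, …, C (K-1)` charged in Gram form; an even `V` without constant part; a
  tracked sequence `L j` of even elements whose positive-degree kernels flow linearly
  (`kernel_m (e^{Δ_{C j}} L_j) = kernel_m L_{j+1}`, `m ≥ 1`) with pinned norms `≤ NL j`; majorants `NH j` with `NH 0 ≥` the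
  pinned norms of `V - L 0`, `θ_j = eα_j‖V^{(j)}‖_{h_j}[NL j + NH j]/κ_j² < 1` and
  `NH (j+1) m ≥ ρ_j^{-m} e ‖·‖_{h_j}[NH j] + ρ_j^{-m} e‖·‖_{h_j}[NL j + NH j] θ_j/(1-θ_j)`: then for all `n ≤ K` the
  single-slice partition functions are units, `V^{(n)} = iterEffAction C n V` is even without constant part, and the pinned
  kernel norms of `V^{(n)} - L n` are `≤ NH n m` in every degree `m ≥ 1`.

Everything is proved; no definition, no named fact.

## Sources

G. Benfatto, A. Giuliani, V. Mastropietro, Ann. Henri Poincaré 7 (2006) 809–898, (2.13)–(2.14), (2.77)–(2.80),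
(2.86)–(2.90) [`BenfattoGiulianiMastropietro2006`]; K. Gawȩdzki, A. Kupiainen, Comm. Math. Phys. 102 (1985) 1–30, §3
[`GawedzkiKupiainen1985GrossNeveu`]; M. Salmhofer, *Renormalization* (1999), §4.3 [`Salmhofer1999`].
-/

noncomputable section

namespace Literature.MathematicalPhysics.QuantumLattice

open GrassmannAlgebra Finset Literature.Probability.LatticeModels
open scoped InnerProductSpace Nat

variable {𝕜 : Type*} [RCLike 𝕜] {Γ : Type*} [Fintype Γ] [DecidableEq Γ]

/-! ### The Gaussian convolution in Gram form -/

/-- **The linear part of the renormalisation-group map in Gram form** (the first cumulant of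
`GrassmannCumulantActionBound.sum_norm_kernel_cumulantOf_le_pow`; Benfatto–Giuliani–Mastropietro 2006, (2.77)–(2.80) at first
order): for an even `H` with pinned kernel norms `≤ N(m')` in degree `2m'`, a charged covariance in Gram form with constant
`κ` and an output field weight `ρ > 0`, in every degree `m` with one output label pinned,
`Σ_{W : W_i = w} ‖kernel_m (e^{Δ_C} H) (W)‖ ≤ ρ^{-m} · e · ‖H‖_h`, `‖H‖_h = Σ_{m'} (e²(κ+ρ))^{2m'} N(m')` — no count of Wick
pairings, hence no factorial in the degree. [cite: BenfattoGiulianiMastropietro2006, (2.77)-(2.80)] -/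
theorem sum_norm_kernel_gaussConv_le_normV {E : Type*} [NormedAddCommGroup E] [InnerProductSpace 𝕜 E]
    (C : Matrix Γ Γ 𝕜) (q : Γ → Bool) (hC : ∀ X Y, q X = q Y → C X Y = 0) (f g : Γ → E) {κ : ℝ} (hκ : 0 < κ)
    (hf : ∀ X, q X = true → ‖f X‖ ≤ κ) (hg : ∀ Y, q Y = false → ‖g Y‖ ≤ κ)
    (hG : ∀ X Y, q X = true → q Y = false → contr 𝕜 C X Y = ⟪f X, g Y⟫_𝕜)
    (H : GrassmannAlgebra 𝕜 Γ) (hH : H ∈ evenPart 𝕜 Γ) (N : ℕ → ℝ) (hN0 : ∀ m', 0 ≤ N m')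
    (hN : ∀ m' (j : Fin (2 * m')) (w : Γ), ∑ Y ∈ univ.filter (fun Y : Fin (2 * m') → Γ => Y j = w), ‖kernel 𝕜 H (2 * m') Y‖ ≤ N m')
    {α : ℝ} (hα : 0 < α) (hrow : ∀ X, ∑ Y, ‖C X Y‖ ≤ α) (hcol : ∀ Y, ∑ X, ‖C X Y‖ ≤ α) {ρ : ℝ} (hρ : 0 < ρ)
    {m : ℕ} (i : Fin m) (w : Γ) :
    ∑ W ∈ univ.filter (fun W : Fin m → Γ => W i = w), ‖kernel 𝕜 (gaussConv 𝕜 C H) m W‖ ≤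
      ρ⁻¹ ^ m * (Real.exp 1 * normV Γ κ ρ N) := by
  set X : evenPart 𝕜 Γ := ⟨H, hH⟩ with hX
  set degs : Finset ℕ := range (Fintype.card Γ / 2 + 1) with hdegs
  set K : (m' : ℕ) → (Fin (2 * m') → Γ) → 𝕜 := fun m' => kernel 𝕜 H (2 * m') with hK
  have hXv : vertexOf 𝕜 degs K = X := Subtype.ext (coe_vertexOf_kernel_eq 𝕜 X)
  have h := sum_norm_kernel_cumulantOf_le_pow C q hC f g hκ hf hg hG degs K N hN0 (fun m' j w' => hN m' j w') hα hrow hcol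
    hρ one_pos i w
  have hcum : ((cumulantOf (fun k => evenGaussConv 𝕜 C (vertexOf 𝕜 degs K ^ k)) 1 : evenPart 𝕜 Γ) : GrassmannAlgebra 𝕜 Γ) =
      gaussConv 𝕜 C H := by
    rw [cumulantOf_one, pow_one, hXv, coe_evenGaussConv]
  rw [hcum] at h
  refine h.trans (le_of_eq ?_)
  have hnV : ∑ m' ∈ degs, (Real.exp 2 * (κ + ρ)) ^ (2 * m') * N m' = normV Γ κ ρ N := rfl
  rw [hnV]
  simp only [Nat.factorial_one, Nat.cast_one, one_mul, Nat.sub_self, mul_zero, pow_zero, pow_one]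
  ring

/-! ### The flow of majorants with a tracked linear part -/

/-- **Iterating the single-scale step with a tracked linear part.**  Slices `C 0, C 1, …` on one label set, charged for the
same charge map `q` and in Gram form on the mixed pairs (constants `κ j`, vectors `f j, g j`), with row and column sums of
`‖C j‖` at most `α j` and output field weights `ρ j`; an even interaction `V` without constant part; a TRACKED sequence
`L j` of even elements whose kernels of positive degree flow linearly
(`kernel_m (e^{Δ_{C j}} L_j) = kernel_m L_{j+1}`, `m ≥ 1` — e.g. the explicit Wick images of the local quartic and quadratic
terms) with pinned norms `≤ NL j m`; and majorants `NH j m ≥ 0` of the untracked part with `NH 0 ≥` the pinned norms of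
`V - L 0`, and for every slice `j < K`: `θ_j = e α_j ‖·‖_{h_j}[NL j + NH j]/κ_j² < 1` and
`NH (j+1) m ≥ ρ_j^{-m} e ‖·‖_{h_j}[NH j] + ρ_j^{-m} e ‖·‖_{h_j}[NL j + NH j] θ_j/(1 - θ_j)` for `m ≥ 1` (first cumulant of the
untracked part in Gram form + the second-order remainder of the whole).  Then for every `n ≤ K`: the single-slice partition
functions `∫dμ_{C j} e^{-V^{(j)}}`, `j < n`, are units; `V^{(n)} = iterEffAction C n V` is even without constant part; and
`Σ_{Y : Y_p = w} ‖kernel (V^{(n)} - L n) m Y‖ ≤ NH n m` for all `m ≥ 1`, `p`, `w` (Benfatto–Giuliani–Mastropietro 2006,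
(2.86)–(2.90): away from the tracked part everything moves at second order). [cite: BenfattoGiulianiMastropietro2006, (2.77)-(2.80) and (2.86)-(2.90)] -/
theorem iterEffAction_splitFlow {E : Type*} [NormedAddCommGroup E] [InnerProductSpace 𝕜 E]
    (q : Γ → Bool) (C : ℕ → Matrix Γ Γ 𝕜) (hC : ∀ j X Y, q X = q Y → C j X Y = 0)
    (f g : ℕ → Γ → E) (κ : ℕ → ℝ) (hκ : ∀ j, 0 < κ j)
    (hf : ∀ j X, q X = true → ‖f j X‖ ≤ κ j) (hg : ∀ j Y, q Y = false → ‖g j Y‖ ≤ κ j)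
    (hG : ∀ j X Y, q X = true → q Y = false → contr 𝕜 (C j) X Y = ⟪f j X, g j Y⟫_𝕜)
    (α : ℕ → ℝ) (hα : ∀ j, 0 < α j) (hrow : ∀ j X, ∑ Y, ‖C j X Y‖ ≤ α j) (hcol : ∀ j Y, ∑ X, ‖C j X Y‖ ≤ α j)
    (ρ : ℕ → ℝ) (hρ : ∀ j, 0 < ρ j)
    (V : GrassmannAlgebra 𝕜 Γ) (hV : V ∈ evenPart 𝕜 Γ) (hV0 : constPart 𝕜 V = 0)
    (L : ℕ → GrassmannAlgebra 𝕜 Γ) (hL : ∀ j, L j ∈ evenPart 𝕜 Γ)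
    (hLflow : ∀ j, ∀ m, 0 < m → ∀ Y : Fin m → Γ, kernel 𝕜 (gaussConv 𝕜 (C j) (L j)) m Y = kernel 𝕜 (L (j + 1)) m Y)
    (NL NH : ℕ → ℕ → ℝ) (hNL0 : ∀ j m, 0 ≤ NL j m) (hNH0 : ∀ j m, 0 ≤ NH j m)
    (hNL : ∀ (j m : ℕ) (p : Fin m) (w : Γ), ∑ Y ∈ univ.filter (fun Y : Fin m → Γ => Y p = w), ‖kernel 𝕜 (L j) m Y‖ ≤ NL j m)
    (hNHV : ∀ (m : ℕ) (p : Fin m) (w : Γ),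
      ∑ Y ∈ univ.filter (fun Y : Fin m → Γ => Y p = w), ‖kernel 𝕜 (V - L 0) m Y‖ ≤ NH 0 m)
    (K : ℕ)
    (hθ : ∀ j < K, Real.exp 1 * α j * normV Γ (κ j) (ρ j) (fun m' => NL j (2 * m') + NH j (2 * m')) / κ j ^ 2 < 1)
    (hstep : ∀ j < K, ∀ m, 0 < m →
      (ρ j)⁻¹ ^ m * (Real.exp 1 * normV Γ (κ j) (ρ j) (fun m' => NH j (2 * m'))) +
        (ρ j)⁻¹ ^ m * (Real.exp 1 * normV Γ (κ j) (ρ j) (fun m' => NL j (2 * m') + NH j (2 * m'))) *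
          (Real.exp 1 * α j * normV Γ (κ j) (ρ j) (fun m' => NL j (2 * m') + NH j (2 * m')) / κ j ^ 2) /
            (1 - Real.exp 1 * α j * normV Γ (κ j) (ρ j) (fun m' => NL j (2 * m') + NH j (2 * m')) / κ j ^ 2) ≤
        NH (j + 1) m) :
    ∀ n ≤ K, (∀ j < n, IsUnit (effPartitionFn 𝕜 (C j) (iterEffAction 𝕜 C j V))) ∧
      iterEffAction 𝕜 C n V ∈ evenPart 𝕜 Γ ∧ constPart 𝕜 (iterEffAction 𝕜 C n V) = 0 ∧
      ∀ (m : ℕ), 0 < m → ∀ (p : Fin m) (w : Γ),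
        ∑ Y ∈ univ.filter (fun Y : Fin m → Γ => Y p = w), ‖kernel 𝕜 (iterEffAction 𝕜 C n V - L n) m Y‖ ≤ NH n m := by
  intro n
  induction n with
  | zero =>
    intro _
    refine ⟨fun j hj => absurd hj (Nat.not_lt_zero j), ?_, ?_, ?_⟩
    · rw [iterEffAction_zero]; exact hV
    · rw [iterEffAction_zero]; exact hV0
    · intro m _ p w; rw [iterEffAction_zero]; exact hNHV m p w
  | succ n ih =>
    intro hn
    have hnK : n < K := Nat.lt_of_succ_le hn
    obtain ⟨hunits, heven, hconst, hker⟩ := ih hnK.le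
    set Vn := iterEffAction 𝕜 C n V with hVn
    -- the pinned norms of `V^{(n)} = L n + (V^{(n)} - L n)`
    have hNV : ∀ (m : ℕ) (p : Fin m) (w : Γ),
        ∑ Y ∈ univ.filter (fun Y : Fin m → Γ => Y p = w), ‖kernel 𝕜 Vn m Y‖ ≤ NL n m + NH n m := by
      intro m p w
      rcases Nat.eq_zero_or_pos m with rfl | hm
      · exact absurd p.2 (Nat.not_lt_zero _)
      · have hsplit : ∀ Y, kernel 𝕜 Vn m Y = kernel 𝕜 (L n) m Y + kernel 𝕜 (Vn - L n) m Y := by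
          intro Y; rw [← kernel_add]; congr 1; abel
        calc ∑ Y ∈ univ.filter (fun Y : Fin m → Γ => Y p = w), ‖kernel 𝕜 Vn m Y‖
            ≤ ∑ Y ∈ univ.filter (fun Y : Fin m → Γ => Y p = w), (‖kernel 𝕜 (L n) m Y‖ + ‖kernel 𝕜 (Vn - L n) m Y‖) :=
              sum_le_sum fun Y _ => by rw [hsplit Y]; exact norm_add_le _ _
          _ ≤ NL n m + NH n m := by rw [sum_add_distrib]; exact add_le_add (hNL n m p w) (hker m hm p w)
    have hN2 : ∀ (m' : ℕ) (j : Fin (2 * m')) (w : Γ),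
        ∑ Y ∈ univ.filter (fun Y : Fin (2 * m') → Γ => Y j = w), ‖kernel 𝕜 Vn (2 * m') Y‖ ≤ NL n (2 * m') + NH n (2 * m') :=
      fun m' j w => hNV (2 * m') j w
    -- the second-order remainder of the whole and the unit
    obtain ⟨hunit, hrem⟩ := sum_norm_kernel_effAction_sub_gaussConv_le (C n) q (hC n) (f n) (g n) (hκ n) (hf n) (hg n) (hG n)
      Vn heven hconst (fun m' => NL n (2 * m') + NH n (2 * m')) (fun m' => add_nonneg (hNL0 n _) (hNH0 n _)) hN2 (hα n)
      (hrow n) (hcol n) (hρ n) (hθ n hnK)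
    -- the first cumulant of the untracked part, in Gram form
    have hH : Vn - L n ∈ evenPart 𝕜 Γ := Subalgebra.sub_mem _ heven (hL n)
    have hlin : ∀ {m : ℕ} (p : Fin m) (w : Γ),
        ∑ Y ∈ univ.filter (fun Y : Fin m → Γ => Y p = w), ‖kernel 𝕜 (gaussConv 𝕜 (C n) (Vn - L n)) m Y‖ ≤
          (ρ n)⁻¹ ^ m * (Real.exp 1 * normV Γ (κ n) (ρ n) (fun m' => NH n (2 * m'))) := by
      intro m p w
      refine sum_norm_kernel_gaussConv_le_normV (C n) q (hC n) (f n) (g n) (hκ n) (hf n) (hg n) (hG n) (Vn - L n) hH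
        (fun m' => NH n (2 * m')) (fun m' => hNH0 n _) (fun m' j w' => ?_) (hα n) (hrow n) (hcol n) (hρ n) p w
      rcases Nat.eq_zero_or_pos m' with rfl | hm'
      · exact absurd j.2 (by simp)
      · exact hker (2 * m') (by omega) j w'
    refine ⟨fun j hj => ?_, ?_, ?_, ?_⟩
    · rcases Nat.lt_succ_iff_lt_or_eq.1 hj with hj' | rfl
      · exact hunits j hj'
      · exact hunit
    · rw [iterEffAction_succ]; exact effAction_mem_evenPart (C n) heven hconst
    · rw [iterEffAction_succ]; exact constPart_effAction 𝕜 (C n) Vn hunit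
    · intro m hm p w
      rw [iterEffAction_succ]
      -- `V^{(n+1)} - L (n+1) = (effAction - e^{Δ}V^{(n)}) + e^{Δ}(V^{(n)} - L n)` in every positive degree
      have hsplit : ∀ Y : Fin m → Γ, kernel 𝕜 (effAction 𝕜 (C n) Vn - L (n + 1)) m Y =
          kernel 𝕜 (effAction 𝕜 (C n) Vn - gaussConv 𝕜 (C n) Vn) m Y + kernel 𝕜 (gaussConv 𝕜 (C n) (Vn - L n)) m Y := by
        intro Y
        have hL' : kernel 𝕜 (L (n + 1)) m Y = kernel 𝕜 (gaussConv 𝕜 (C n) (L n)) m Y := (hLflow n m hm Y).symm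
        have e1 : effAction 𝕜 (C n) Vn - L (n + 1) = (effAction 𝕜 (C n) Vn - gaussConv 𝕜 (C n) Vn) +
            (gaussConv 𝕜 (C n) (Vn - L n)) + (gaussConv 𝕜 (C n) (L n) - L (n + 1)) := by
          rw [map_sub]; abel
        rw [e1, kernel_add, kernel_add, show gaussConv 𝕜 (C n) (L n) - L (n + 1) =
          gaussConv 𝕜 (C n) (L n) + (-1 : 𝕜) • L (n + 1) by rw [neg_one_smul, sub_eq_add_neg], kernel_add, kernel_smul,
          hL']
        ring
      calc ∑ Y ∈ univ.filter (fun Y : Fin m → Γ => Y p = w), ‖kernel 𝕜 (effAction 𝕜 (C n) Vn - L (n + 1)) m Y‖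
          ≤ ∑ Y ∈ univ.filter (fun Y : Fin m → Γ => Y p = w), (‖kernel 𝕜 (effAction 𝕜 (C n) Vn - gaussConv 𝕜 (C n) Vn) m Y‖ +
              ‖kernel 𝕜 (gaussConv 𝕜 (C n) (Vn - L n)) m Y‖) :=
            sum_le_sum fun Y _ => by rw [hsplit Y]; exact norm_add_le _ _
        _ ≤ (ρ n)⁻¹ ^ m * (Real.exp 1 * normV Γ (κ n) (ρ n) (fun m' => NL n (2 * m') + NH n (2 * m'))) *
              (Real.exp 1 * α n * normV Γ (κ n) (ρ n) (fun m' => NL n (2 * m') + NH n (2 * m')) / κ n ^ 2) /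
                (1 - Real.exp 1 * α n * normV Γ (κ n) (ρ n) (fun m' => NL n (2 * m') + NH n (2 * m')) / κ n ^ 2) +
            (ρ n)⁻¹ ^ m * (Real.exp 1 * normV Γ (κ n) (ρ n) (fun m' => NH n (2 * m'))) := by
            rw [sum_add_distrib]; exact add_le_add (hrem hm p w) (hlin p w)
        _ ≤ NH (n + 1) m := by linarith [hstep n hnK m hm]

end Literature.MathematicalPhysics.QuantumLattice

end
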